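import Summits.QuantumFields.YangMills.Theorems.LuscherReductionTwistedTraceScalingToronFrames
import Mathlib.Analysis.InnerProductSpace.Projection.FiniteDimensional
import HarnessLib

/-!
# Diagonalising frames ADAPTED to an invariant subspace (slow/fast splitting of the normal modes)
# (Born–Oppenheimer bookkeeping for the COARSE lanes of S-BASE, crux `TwistedTraceScaling` stmt-QuantumFields-20203; design
# `pub/ym-fleet/ym-luscher-20007-p1/COARSE-DESIGN.md` §14)

For a real linear map `D : E → F` between finite-dimensional inner-product spaces and a subspace `S ≤ E` invariant under `T = D†D` (e.g. the span of some
eigenvectors — for lattice Yang–Mills at a flat background: the nine constant modes), there is an orthonormal frame diagonalising `‖D·‖²` (`Frame.IsDiag`)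
EVERY vector of which lies either in `S` or in `Sᗮ` (★ `Frame.exists_isDiag_adapted`).  Construction: Mathlib's eigenframe of the shifted symmetric operator
`T − μ·P_S` with `μ` larger than `‖D‖²`: its negative eigenvectors lie in `S`, the others in `Sᗮ`.  Such a frame is what the windowed harmonic step
(`Literature.…GaussianTransferKernelWindow`, p573252) consumes: window = the frame vectors in `Sᗮ` (stiff), slow = those in `S`.
Also `Frame.IsDiag.apply_eq_smul` (a diagonalising frame is an eigenframe of any `T` representing the form) and `Frame.mem_span_of_adapted`.

HONEST FRAMING: finite-dimensional linear algebra; femto rung R2b1 (brick for a stub of a child of a CONDITIONAL route); not a gap, not Clay.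
-/

set_option autoImplicit false

noncomputable section

open scoped BigOperators InnerProductSpace RealInnerProductSpace

namespace Summit.QuantumFields.YangMills.Theorems.FemtoTransferGap.TwoLattice.Toron.Frame

variable {E F : Type*} [NormedAddCommGroup E] [InnerProductSpace ℝ E] [FiniteDimensional ℝ E]
  [NormedAddCommGroup F] [InnerProductSpace ℝ F] [FiniteDimensional ℝ F]
variable {ι : Type*} [Fintype ι] [DecidableEq ι]

omit [FiniteDimensional ℝ E] [FiniteDimensional ℝ F] in
/-- A diagonalising frame is an EIGENFRAME of every operator representing the form: `⟪x, Ty⟫ = ⟪Dx, Dy⟫ ⇒ T eᵢ = aᵢ eᵢ`. [cite: HornJohnson2013, Thm 2.5.6] -/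
theorem IsDiag.apply_eq_smul {D : E →ₗ[ℝ] F} {e : OrthonormalBasis ι ℝ E} {a : ι → ℝ} (h : IsDiag D e a) {T : E →ₗ[ℝ] E}
    (hT : ∀ x y, ⟪x, T y⟫ = ⟪D x, D y⟫) (i : ι) : T (e i) = a i • e i := by
  rw [← e.sum_repr' (T (e i))]
  have hc : ∀ j, ⟪e j, T (e i)⟫ = if j = i then a i else 0 := fun j => by
    rw [hT, h j i]
    split_ifs with hji
    · subst hji; rfl
    · rfl
  simp_rw [hc, ite_smul, zero_smul, Finset.sum_ite_eq', Finset.mem_univ, if_true]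

omit [FiniteDimensional ℝ E] [DecidableEq ι] in
/-- In a frame adapted to `S` (every vector in `S` or in `Sᗮ`), every element of `S` is spanned by the frame vectors lying in `S`. [folklore] -/
theorem mem_span_of_adapted {e : OrthonormalBasis ι ℝ E} {S : Submodule ℝ E} (hadapt : ∀ i, e i ∈ S ∨ e i ∈ Sᗮ) {s : E} (hs : s ∈ S) :
    s ∈ Submodule.span ℝ (Set.range fun i : {i // e i ∈ S} => e (i : ι)) := by
  rw [← e.sum_repr' s]
  refine Submodule.sum_mem _ fun i _ => ?_
  rcases hadapt i with hi | hi
  · exact Submodule.smul_mem _ _ (Submodule.subset_span ⟨⟨i, hi⟩, rfl⟩)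
  · rw [Submodule.inner_left_of_mem_orthogonal hs hi, zero_smul]
    exact Submodule.zero_mem _

omit [FiniteDimensional ℝ E] in
/-- If `x ∈ S`, `y ∈ Sᗮ` and `x + y = 0` then `x = 0`. [folklore] -/
theorem eq_zero_of_add_eq_zero_of_mem {S : Submodule ℝ E} {x y : E} (hx : x ∈ S) (hy : y ∈ Sᗮ) (hxy : x + y = 0) : x = 0 := by
  have h1 : ⟪x, x⟫ = 0 := by
    have : x = -y := eq_neg_of_add_eq_zero_left hxy
    rw [this, inner_neg_left, inner_neg_right, neg_neg]
    rw [this] at hx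
    have hy' : y ∈ S := by simpa using S.neg_mem hx
    exact Submodule.inner_right_of_mem_orthogonal hy' hy
  exact inner_self_eq_zero.mp h1

/-- ★ **ADAPTED DIAGONALISING FRAME**: if `S` is invariant under `D†D`, there is an orthonormal frame diagonalising `‖D·‖²` whose every vector lies in `S`
or in `Sᗮ` (values `aᵢ = ‖D eᵢ‖²`). [cite: HornJohnson2013, Thm 2.5.6] -/
theorem exists_isDiag_adapted (D : E →ₗ[ℝ] F) (S : Submodule ℝ E) (hS : ∀ s ∈ S, D.adjoint (D s) ∈ S) :
    ∃ (n : ℕ) (e : OrthonormalBasis (Fin n) ℝ E), IsDiag D e (fun i => ‖D (e i)‖ ^ 2) ∧ ∀ i, e i ∈ S ∨ e i ∈ Sᗮ := by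
  classical
  set T : E →ₗ[ℝ] E := D.adjoint ∘ₗ D with hTdef
  have hT : ∀ x y, ⟪x, T y⟫ = ⟪D x, D y⟫ := fun x y => by rw [hTdef, LinearMap.comp_apply, LinearMap.adjoint_inner_right]
  have hTsymm : T.IsSymmetric := fun x y => by rw [real_inner_comm, hT, real_inner_comm, ← hT]
  -- the bound `‖Dx‖² ≤ C‖x‖²`
  set C : ℝ := ‖LinearMap.toContinuousLinearMap D‖ ^ 2 with hC
  have hbound : ∀ x, ‖D x‖ ^ 2 ≤ C * ‖x‖ ^ 2 := fun x => by
    have h := (LinearMap.toContinuousLinearMap D).le_opNorm x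
    rw [LinearMap.coe_toContinuousLinearMap'] at h
    rw [hC, ← mul_pow]
    exact pow_le_pow_left₀ (norm_nonneg _) h 2
  set μ : ℝ := C + 1 with hμ
  set P : E →ₗ[ℝ] E := ((S.starProjection : E →L[ℝ] E) : E →ₗ[ℝ] E) with hP
  have hPsymm : P.IsSymmetric := S.starProjection_isSymmetric
  set T' : E →ₗ[ℝ] E := T - μ • P with hT'
  have hT'symm : T'.IsSymmetric := hTsymm.sub (hPsymm.smul (by simp))
  obtain ⟨n, hn⟩ : ∃ n, Module.finrank ℝ E = n := ⟨_, rfl⟩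
  set e := hT'symm.eigenvectorBasis hn with he
  set lam := hT'symm.eigenvalues hn with hlam
  -- invariance of `S` and `Sᗮ` under `T`
  have hTS : ∀ s ∈ S, T s ∈ S := fun s hs => by rw [hTdef, LinearMap.comp_apply]; exact hS s hs
  have hTSo : ∀ w ∈ Sᗮ, T w ∈ Sᗮ := fun w hw => by
    rw [Submodule.mem_orthogonal]
    intro u hu
    rw [← hTsymm u w]
    exact Submodule.inner_right_of_mem_orthogonal (hTS u hu) hw
  -- the dichotomy
  have hadapt : ∀ i, e i ∈ S ∨ e i ∈ Sᗮ := fun i => by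
    set s := P (e i) with hs
    set w := e i - s with hw
    have hsS : s ∈ S := S.starProjection_apply_mem (e i)
    have hwS : w ∈ Sᗮ := S.sub_starProjection_mem_orthogonal (e i)
    have hPs : P s = s := Submodule.starProjection_eq_self_iff.mpr hsS
    have hPw : P w = 0 := (Submodule.starProjection_apply_eq_zero_iff S).mpr hwS
    have hdec : e i = s + w := by rw [hw]; abel
    have heig : T' (e i) = lam i • e i := hT'symm.apply_eigenvectorBasis hn i
    -- split the eigen-equation along `S ⊕ Sᗮ`
    have hsplit : (T s - μ • s - lam i • s) + (T w - lam i • w) = 0 := by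
      have h1 : T' (e i) = T s - μ • s + T w := by
        rw [hdec, hT', LinearMap.sub_apply, LinearMap.smul_apply, map_add, map_add, hPs, hPw, add_zero]
        abel
      rw [h1, hdec, smul_add] at heig
      rw [← sub_eq_zero.mpr heig]
      abel
    have hx : T s - μ • s - lam i • s ∈ S := Submodule.sub_mem _ (Submodule.sub_mem _ (hTS s hsS) (Submodule.smul_mem _ _ hsS))
      (Submodule.smul_mem _ _ hsS)
    have hy : T w - lam i • w ∈ Sᗮ := Submodule.sub_mem _ (hTSo w hwS) (Submodule.smul_mem _ _ hwS)
    have h0s : T s - μ • s - lam i • s = 0 := eq_zero_of_add_eq_zero_of_mem hx hy hsplit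
    have h0w : T w - lam i • w = 0 := by rw [h0s, zero_add] at hsplit; exact hsplit
    -- the Rayleigh quotients
    have hqs : ‖D s‖ ^ 2 = (μ + lam i) * ‖s‖ ^ 2 := by
      rw [← real_inner_self_eq_norm_sq, ← hT, ← real_inner_self_eq_norm_sq]
      have : T s = (μ + lam i) • s := by rw [add_smul, ← sub_eq_zero, ← h0s]; abel
      rw [this, real_inner_smul_right]
    have hqw : ‖D w‖ ^ 2 = lam i * ‖w‖ ^ 2 := by
      rw [← real_inner_self_eq_norm_sq, ← hT, ← real_inner_self_eq_norm_sq]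
      have : T w = lam i • w := (sub_eq_zero.mp h0w)
      rw [this, real_inner_smul_right]
    by_cases hneg : lam i < 0
    · -- `w = 0`
      left
      have hw0 : ‖w‖ ^ 2 = 0 := by nlinarith [sq_nonneg ‖D w‖, sq_nonneg ‖w‖]
      have : w = 0 := by rwa [sq_eq_zero_iff, norm_eq_zero] at hw0
      rw [hdec, this, add_zero]; exact hsS
    · -- `s = 0`
      right
      have hs0 : ‖s‖ ^ 2 = 0 := by nlinarith [hbound s, sq_nonneg ‖s‖, not_lt.mp hneg]
      have : s = 0 := by rwa [sq_eq_zero_iff, norm_eq_zero] at hs0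
      rw [hdec, this, zero_add]; exact hwS
  refine ⟨n, e, fun i j => ?_, hadapt⟩
  by_cases hij : i = j
  · subst hij; rw [if_pos rfl, real_inner_self_eq_norm_sq]; rfl
  · rw [if_neg hij, ← hT]
    -- `⟪e i, T e j⟫ = ⟪e i, T' e j⟫ + μ ⟪e i, P e j⟫ = 0`
    have h1 : T (e j) = T' (e j) + μ • P (e j) := by rw [hT', LinearMap.sub_apply, LinearMap.smul_apply]; abel
    have h2 : ⟪e i, T' (e j)⟫ = 0 := by
      rw [hT'symm.apply_eigenvectorBasis hn j, real_inner_smul_right, orthonormal_iff_ite.mp e.orthonormal i j, if_neg hij, mul_zero]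
    have h3 : ⟪e i, P (e j)⟫ = 0 := by
      rcases hadapt j with hj | hj
      · have hPj : P (e j) = e j := Submodule.starProjection_eq_self_iff.mpr hj
        rw [hPj, orthonormal_iff_ite.mp e.orthonormal i j, if_neg hij]
      · have hPj : P (e j) = 0 := (Submodule.starProjection_apply_eq_zero_iff S).mpr hj
        rw [hPj, inner_zero_right]
    rw [h1, inner_add_right, real_inner_smul_right, h2, h3, mul_zero, add_zero]

end Summit.QuantumFields.YangMills.Theorems.FemtoTransferGap.TwoLattice.Toron.Frame

end
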